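import Summits.AtomisticToContinuum.BoseEinsteinCondensation.Theorems.BECDyadicChainingDyadicCoherenceDefectFreeHaarBandPairings
import Summits.AtomisticToContinuum.BoseEinsteinCondensation.Theorems.BECDyadicChainingDyadicCoherenceDefectFreeHaarBandPerturbation
import Summits.AtomisticToContinuum.BoseEinsteinCondensation.Theorems.BECDyadicChainingDyadicCoherenceDefectFreeDirichletEnergy
import HarnessLib

/-!
# Crux `DyadicCoherenceDefect` (stmt-AtomisticToContinuum-13192), line `registered`:
# the hypothesis `0 < scatteringLength v` of the open stub S1″ is NECESSARY (free-gas witness)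

Supports (does not close) stmt-AtomisticToContinuum-13192. A kernel-checked TIGHTNESS TEST for the
line's one open stub S1″ `stub_haarBandAboveKineticWindow` (Haar-band occupation
`(T_m − T_{m−1})^{1/2} ≤ β_j √N` of Dirichlet near-minimisers at every level above the kinetic window
`c₀(ρa)^{-1/2}`, one summable budget `∑β ≤ b`, `10c₀ + b < 1/4`, stated for `0 < a = a(v)`):

* `haarBandAboveKineticWindow_false_without_posScattering` — the S1″ signature with its hypothesis
  `0 < scatteringLength v` deleted is FALSE. Witness `v = 0`: then `a = 0` and the window condition
  `c₀(ρ·0)^{-1/2} < L/2^m` is void (`0^{-1/2} = 0` in `ℝ`), so the bound is demanded at level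
  `m = 2` for all large `N` with `β_j ≤ ∑β ≤ b < 1/4`, i.e. `T₂ − T₁ ≤ N/16`; but the free Dirichlet
  gas has `δ`-near-minimisers `u^{⊗N}` for every `δ > 0` (`u` the `C¹` tensor mode of stub U,
  `…FreeDirichletEnergy`, `L²`-within `10⁻⁴` of the ray of the sine product by
  `…FreeHaarBandPerturbation`), whose level sums are `T_k = N ∑_m |⟨dyMode_{k,m}, u⟩|²`, within
  `O(10⁻⁴)N` of the sine product's `0.533 N` (level 1) and `0.857 N` (level 2)
  (`…FreeHaarBandPairings`): `T₂ − T₁ > 0.3 N > N/16`.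

Reading. The crux's own DEFECT form holds at `v = 0` (landed `stub_freeAssembly`: a rank-one positive
`γ` has zero defect at every level), while the T-form (Haar band) fails there at level 2: the T-form
reshaping S1″ is strictly stronger than the defect form exactly by the FLATNESS of the condensate
profile at scale `L/4`, which for `a > 0` is an interaction effect (Gross–Pitaevskii healing length
`ξ = (8πρa)^{-1/2} ≪ L`, flat bulk). Any engine for S1″ must therefore use `a > 0` essentially, already
at the two top levels; this is the test a proof of the stub must survive, recorded for the crux's
disprover / TTRL library (D-0021). Elementary numerics: `0.524 ≤ 512/π⁶ ≤ 0.5343`,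
`1.607 ≤ (4 − 2√2)³ ≤ 1.61` (`key_numeric`).

## References

* [LSSY2005] E. H. Lieb, R. Seiringer, J. P. Solovej, J. Yngvason, *The Mathematics of the Bose Gas
  and its Condensation*, Birkhäuser 2005: §1.2 (1.17) (occupations / one-particle density matrix);
  Ch. 2, (2.3) and the remark after (2.50) (free Dirichlet ground state `∏ sin`, energy `3Nπ²/L²`,
  gap `3π²/L²`).
-/

noncomputable section

namespace Summit.AtomisticToContinuum.BoseEinsteinCondensation.Cruxes.DyadicCoherenceDefect.Birth

open Filter MeasureTheory
open scoped ENNReal NNReal BigOperators ComplexConjugate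
open Literature.MathematicalPhysics.QuantumManyBody.BoseGas
open Summit.AtomisticToContinuum.BoseEinsteinCondensation.Theses

namespace FreeHaarBand

variable {n : ℕ} {L : ℝ}

/-! ### Elementary inequalities -/

/-- Lower bound: `|x − αy| ≤ e ⇒ |α|²|y|² − e|α|(|y|²+1) ≤ |x|²`. [folklore] -/
theorem sq_lower_of_norm_sub_le {x y α : ℂ} {e : ℝ} (he : 0 ≤ e) (h : ‖x - α * y‖ ≤ e) :
    ‖α‖ ^ 2 * ‖y‖ ^ 2 - e * ‖α‖ * (‖y‖ ^ 2 + 1) ≤ ‖x‖ ^ 2 := by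
  have hA0 : 0 ≤ ‖α‖ * ‖y‖ := mul_nonneg (norm_nonneg _) (norm_nonneg _)
  have h1 : ‖α‖ * ‖y‖ - e ≤ ‖x‖ := by
    have h2 := norm_sub_norm_le (α * y) x
    rw [norm_mul, ← norm_neg (α * y - x), neg_sub] at h2
    linarith
  have h3 : (‖α‖ * ‖y‖) ^ 2 - 2 * e * (‖α‖ * ‖y‖) ≤ ‖x‖ ^ 2 := by
    rcases le_or_gt (‖α‖ * ‖y‖ - e) 0 with hc | hc
    · nlinarith [norm_nonneg x]
    · nlinarith [norm_nonneg x]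
  have h4 : 2 * (‖α‖ * ‖y‖) ≤ ‖α‖ * (‖y‖ ^ 2 + 1) := by
    nlinarith [norm_nonneg α, norm_nonneg y, sq_nonneg (‖y‖ - 1)]
  nlinarith [mul_le_mul_of_nonneg_left h4 he]

/-- Upper bound: `|x − αy| ≤ e ⇒ |x|² ≤ |α|²|y|² + e|α|(|y|²+1) + e²`. [folklore] -/
theorem sq_upper_of_norm_sub_le {x y α : ℂ} {e : ℝ} (he : 0 ≤ e) (h : ‖x - α * y‖ ≤ e) :
    ‖x‖ ^ 2 ≤ ‖α‖ ^ 2 * ‖y‖ ^ 2 + e * ‖α‖ * (‖y‖ ^ 2 + 1) + e ^ 2 := by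
  have hA0 : 0 ≤ ‖α‖ * ‖y‖ := mul_nonneg (norm_nonneg _) (norm_nonneg _)
  have h1 : ‖x‖ ≤ ‖α‖ * ‖y‖ + e := by
    have h2 := norm_le_norm_add_norm_sub' x (α * y)
    rw [norm_mul] at h2
    linarith
  have h3 : ‖x‖ ^ 2 ≤ (‖α‖ * ‖y‖ + e) ^ 2 := pow_le_pow_left₀ (norm_nonneg x) h1 2
  have h4 : 2 * (‖α‖ * ‖y‖) ≤ ‖α‖ * (‖y‖ ^ 2 + 1) := by
    nlinarith [norm_nonneg α, norm_nonneg y, sq_nonneg (‖y‖ - 1)]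
  nlinarith [mul_le_mul_of_nonneg_left h4 he]

/-- `0.524 ≤ 512/π⁶ ≤ 0.5343`. [folklore] -/
theorem bounds_512_div_pi_pow_six :
    (0.524 : ℝ) ≤ 512 / Real.pi ^ 6 ∧ 512 / Real.pi ^ 6 ≤ 0.5343 := by
  have h1 : (3.14 : ℝ) ^ 6 < Real.pi ^ 6 := pow_lt_pow_left₀ Real.pi_gt_d2 (by norm_num) (by norm_num)
  have h2 : Real.pi ^ 6 < (3.15 : ℝ) ^ 6 :=
    pow_lt_pow_left₀ Real.pi_lt_d2 Real.pi_pos.le (by norm_num)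
  have hpos : 0 < Real.pi ^ 6 := by positivity
  constructor
  · rw [le_div_iff₀ hpos]; nlinarith
  · rw [div_le_iff₀ hpos]; nlinarith

/-- `1.607 ≤ (4 − 2√2)³ ≤ 1.61`. [folklore] -/
theorem bounds_four_sub_two_sqrt_two_cube :
    (1.607 : ℝ) ≤ (4 - 2 * Real.sqrt 2) ^ 3 ∧ (4 - 2 * Real.sqrt 2) ^ 3 ≤ 1.61 := by
  have hlo : (1.414 : ℝ) < Real.sqrt 2 := (Real.lt_sqrt (by norm_num)).2 (by norm_num)
  have hhi : Real.sqrt 2 < (1.4143 : ℝ) := (Real.sqrt_lt' (by norm_num)).2 (by norm_num)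
  have hq1 : (1.1714 : ℝ) ≤ 4 - 2 * Real.sqrt 2 := by linarith
  have hq2 : 4 - 2 * Real.sqrt 2 ≤ (1.172 : ℝ) := by linarith
  have hq0 : (0 : ℝ) ≤ 4 - 2 * Real.sqrt 2 := by linarith
  constructor
  · calc (1.607 : ℝ) ≤ 1.1714 ^ 3 := by norm_num
      _ ≤ (4 - 2 * Real.sqrt 2) ^ 3 := pow_le_pow_left₀ (by norm_num) hq1 3
  · calc (4 - 2 * Real.sqrt 2) ^ 3 ≤ 1.172 ^ 3 := pow_le_pow_left₀ hq0 hq2 3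
      _ ≤ 1.61 := by norm_num

/-- **The numerical heart.** With `B₁ = 512/π⁶ ≈ 0.533` (level one) and
`B₂ = (512/π⁶)(4 − 2√2)³ ≈ 0.857` (level two), perturbations of relative size `e ≤ 10⁻⁴` leave the
level-two sum above the level-one sum by more than `1/16`. [folklore] -/
theorem key_numeric {a e X₁ X₂ : ℝ} (he0 : 0 ≤ e) (he : e ≤ 1 / 10 ^ 4) (ha1 : 1 - e ≤ a)
    (ha2 : a ≤ 1 + e)
    (hX₂ : a ^ 2 * (512 / Real.pi ^ 6 * (4 - 2 * Real.sqrt 2) ^ 3) -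
      e * a * (512 / Real.pi ^ 6 * (4 - 2 * Real.sqrt 2) ^ 3 + 64) ≤ X₂)
    (hX₁ : X₁ ≤ a ^ 2 * (512 / Real.pi ^ 6) + e * a * (512 / Real.pi ^ 6 + 8) + 8 * e ^ 2) :
    1 / 16 < X₂ - X₁ := by
  obtain ⟨hP1, hP2⟩ := bounds_512_div_pi_pow_six
  obtain ⟨hQ1, hQ2⟩ := bounds_four_sub_two_sqrt_two_cube
  set P : ℝ := 512 / Real.pi ^ 6 with hP
  set Q : ℝ := (4 - 2 * Real.sqrt 2) ^ 3 with hQ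
  have ha0 : 0.9999 ≤ a := by linarith
  have ha3 : a ≤ 1.0001 := by linarith
  have h1 : 0.318 ≤ P * (Q - 1) := by nlinarith
  have h2 : 0.9998 ≤ a ^ 2 := by nlinarith
  have h3 : 0.9998 * 0.318 ≤ a ^ 2 * (P * (Q - 1)) := by nlinarith
  have h4 : P * Q ≤ 0.5343 * 1.61 := by nlinarith
  have h5 : e * a ≤ 1 / 10 ^ 4 * 1.0001 := by nlinarith
  have h5' : 0 ≤ e * a := by nlinarith
  have h6 : e * a * (P * Q + 64 + P + 8) ≤ 1 / 10 ^ 4 * 1.0001 * 73.4 := by nlinarith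
  have h7 : 8 * e ^ 2 ≤ 8 * (1 / 10 ^ 4) ^ 2 := by nlinarith
  have h8 : a ^ 2 * P ≤ a ^ 2 * P := le_rfl
  nlinarith

/-- The route's open-cube level occupations are the dyadic coherent sums `cohSum` (the open cubes are
a.e. the half-open cells). [folklore] -/
theorem levelSum_eq_cohSum (N : ℕ) (L : ℝ) (Ψ : Config N → ℂ) (k : ℕ) :
    ∑ i : Fin 3 → Fin (2 ^ k), occupation N (Set.indicator
        {x : EuclideanSpace ℝ (Fin 3) | ∀ q : Fin 3, x q ∈ Set.Ioo (((i q : ℕ) : ℝ) * (L / 2 ^ k))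
          ((((i q : ℕ) : ℝ) + 1) * (L / 2 ^ k))}
        (fun _ => ((Real.sqrt ((L / 2 ^ k) ^ 3))⁻¹ : ℂ))) Ψ = cohSum N L k Ψ := by
  unfold cohSum
  exact Finset.sum_congr rfl fun i _ => occupation_congr_ae (indicator_ae_eq_of_ae_eq_set
    (Summit.AtomisticToContinuum.BoseEinsteinCondensation.Theorems.CoherentAmplitudeMonotone.openCell_ae_eq_dyCell
      L k i)) Ψ

end FreeHaarBand

open FreeHaarBand in
/-- **The hypothesis `0 < scatteringLength v` of the open stub S1″ `stub_haarBandAboveKineticWindow`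
is necessary: without it the statement is FALSE**, refuted by the free gas `v = 0`.

For `v = 0` the window condition `c₀ (ρa)^{-1/2} < L/2^m` is void (`a = 0`, `0^{-1/2} = 0` in `ℝ`),
so the T-form bound `(T_m − T_{m−1})^{1/2} ≤ β_j √N` is demanded at every level `m ≥ 1` with cube
side `≥ ℓ_d`, in particular at `m = 2` for all large `N`, with `β_j ≤ ∑β ≤ b < 1/4`. But the free
Dirichlet gas has `δ`-near-minimisers `u^{⊗N}` (`u` a `C¹` tensor mode within `(δL²/3π²N)^{1/2}` of
the sine product `s = ∏_q (2/L)^{1/2} sin(πx_q/L)`, stubs U/G of this line), for which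
`T_m = N ∑_C |⟨φ_C, u⟩|²`; for the sine product `∑_{level 1} |⟨φ_C, s⟩|² = (8/π²)³ ≈ 0.533` while
`∑_{level 2} |⟨φ_C, s⟩|² = (8/π²)³(4 − 2√2)³ ≈ 0.857`, so `T₂ − T₁ ≈ 0.32 N > N/16`: the level-two
Haar band of the free condensate is macroscopic although its coherence DEFECT vanishes (landed
`stub_freeAssembly`). Hence the T-form reshaping S1″ of the crux is strictly stronger than the
crux's defect form exactly by the flatness of the condensate profile at scale `L/4`, which for
`a > 0` is an interaction effect (healing length `ξ ≪ L`); any proof of S1″ must use `a > 0`.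
[cite: LSSY2005, Ch. 2, (2.3) and after (2.50)] -/
theorem haarBandAboveKineticWindow_false_without_posScattering :
    ¬ (∀ v : ℝ → ℝ≥0∞, IsRepulsiveFiniteRange v →
      ∃ c₀ b ℓd : ℝ, 0 < c₀ ∧ 0 ≤ b ∧ 10 * c₀ + b < 1 / 4 ∧ 0 < ℓd ∧
      ∃ ρ₀ : ℝ, 0 < ρ₀ ∧ ∀ ρ : ℝ, 0 < ρ → ρ < ρ₀ →
        ∃ β : ℕ → ℝ, (∀ j, 0 ≤ β j) ∧ Summable β ∧ ∑' j, β j ≤ b ∧ ∀ᶠ N : ℕ in atTop,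
          let a : ℝ := (scatteringLength v).toReal
          let L : ℝ := sideLength ρ N
          let φ : (m : ℕ) → (Fin 3 → Fin (2 ^ m)) → EuclideanSpace ℝ (Fin 3) → ℂ := fun m i =>
            Set.indicator {x : EuclideanSpace ℝ (Fin 3) | ∀ k : Fin 3, x k ∈
                Set.Ioo (((i k : ℕ) : ℝ) * (L / 2 ^ m)) ((((i k : ℕ) : ℝ) + 1) * (L / 2 ^ m))}
              (fun _ => ((Real.sqrt ((L / 2 ^ m) ^ 3))⁻¹ : ℂ))
          ∃ δ : ℝ≥0∞, 0 < δ ∧ ∀ Ψ : TrialState N L, energy v Ψ ≤ groundStateEnergy v N L + δ →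
            let T : ℕ → ℝ≥0∞ := fun m => ∑ i : Fin 3 → Fin (2 ^ m), occupation N (φ m i) Ψ.ψ
            ∀ m j : ℕ, 1 ≤ m → ℓd * 2 ^ j ≤ L / 2 ^ m → L / 2 ^ m < ℓd * 2 ^ (j + 1) →
              c₀ * (ρ * a) ^ (-(1 : ℝ) / 2) < L / 2 ^ m →
              (T m - T (m - 1)) ^ (1 / 2 : ℝ) ≤ ENNReal.ofReal (β j) * (N : ℝ≥0∞) ^ (1 / 2 : ℝ)) := by
  intro H
  have hv : IsRepulsiveFiniteRange (0 : ℝ → ℝ≥0∞) := ⟨measurable_const, 0, fun _ _ => rfl⟩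
  obtain ⟨c₀, b, ℓd, hc₀, hb, hcb, hℓd, ρ₀, hρ₀, H1⟩ := H 0 hv
  have hρ : 0 < ρ₀ / 2 := half_pos hρ₀
  obtain ⟨β, hβ0, hβs, hβb, hev⟩ := H1 (ρ₀ / 2) hρ (half_lt_self hρ₀)
  have hevL : ∀ᶠ N : ℕ in atTop, 4 * ℓd ≤ sideLength (ρ₀ / 2) N :=
    (tendsto_sideLength_atTop hρ).eventually_ge_atTop _
  obtain ⟨N, hN, hNL, hN1⟩ := (hev.and (hevL.and (eventually_ge_atTop 1))).exists
  obtain ⟨n, rfl⟩ : ∃ n, N = n + 1 := ⟨N - 1, by omega⟩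
  obtain ⟨δ, hδ, HΨ⟩ := hN
  set ρ : ℝ := ρ₀ / 2 with hρ_def
  set L : ℝ := sideLength ρ (n + 1) with hL_def
  have hL : 0 < L := sideLength_pos_of_pos hρ (Nat.succ_pos n)
  -- the bracket of level 2
  have hx : 1 ≤ L / 2 ^ 2 / ℓd := by
    rw [le_div_iff₀ hℓd, one_mul]
    have : L / 2 ^ 2 = L / 4 := by norm_num
    linarith
  obtain ⟨j, hj1, hj2⟩ := exists_nat_pow_near hx one_lt_two
  have hbr1 : ℓd * 2 ^ j ≤ L / 2 ^ 2 := by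
    have := (le_div_iff₀ hℓd).mp hj1
    linarith [mul_comm ((2 : ℝ) ^ j) ℓd]
  have hbr2 : L / 2 ^ 2 < ℓd * 2 ^ (j + 1) := by
    have := (div_lt_iff₀ hℓd).mp hj2
    linarith [mul_comm ((2 : ℝ) ^ (j + 1)) ℓd]
  have hβj : β j < 1 / 4 := by
    have h1 : β j ≤ ∑' i, β i := hβs.le_tsum j (fun i _ => hβ0 i)
    linarith
  have hwin : c₀ * (ρ * (scatteringLength 0).toReal) ^ (-(1 : ℝ) / 2) < L / 2 ^ 2 := by
    rw [scatteringLength_zero, ENNReal.toReal_zero, mul_zero, Real.zero_rpow (by norm_num), mul_zero]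
    positivity
  -- the energy slack `η`
  set δ₁ : ℝ≥0∞ := min δ 1 with hδ₁_def
  have hδ₁0 : 0 < δ₁ := lt_min hδ one_pos
  have hδ₁top : δ₁ ≠ ⊤ := ne_top_of_le_ne_top ENNReal.one_ne_top (min_le_right _ _)
  have hδ₁le : δ₁ ≤ δ := min_le_left _ _
  have hNpos : (0 : ℝ) < ((n + 1 : ℕ) : ℝ) := by exact_mod_cast Nat.succ_pos n
  set η₀ : ℝ := δ₁.toReal / (3 * ((n + 1 : ℕ) : ℝ)) with hη₀_def
  have hη₀ : 0 < η₀ := div_pos (ENNReal.toReal_pos hδ₁0.ne' hδ₁top) (by positivity)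
  set η : ℝ := min η₀ (Real.pi ^ 2 / L ^ 2 * (1 / 10 ^ 4) ^ 2) with hη_def
  have hη : 0 < η := lt_min hη₀ (by positivity)
  have hηt : η * L ^ 2 / Real.pi ^ 2 ≤ (1 / 10 ^ 4) ^ 2 := by
    have h1 : η ≤ Real.pi ^ 2 / L ^ 2 * (1 / 10 ^ 4) ^ 2 := min_le_right _ _
    rw [div_le_iff₀ (by positivity)]
    have hL2 : 0 < L ^ 2 := by positivity
    calc η * L ^ 2 ≤ Real.pi ^ 2 / L ^ 2 * (1 / 10 ^ 4) ^ 2 * L ^ 2 :=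
          mul_le_mul_of_nonneg_right h1 hL2.le
      _ = (1 / 10 ^ 4) ^ 2 * Real.pi ^ 2 := by field_simp
  have hε : Real.sqrt (η * L ^ 2 / Real.pi ^ 2) ≤ 1 / 10 ^ 4 := by
    calc Real.sqrt (η * L ^ 2 / Real.pi ^ 2) ≤ Real.sqrt ((1 / 10 ^ 4) ^ 2) := Real.sqrt_le_sqrt hηt
      _ = 1 / 10 ^ 4 := Real.sqrt_sq (by norm_num)
  -- the witness mode and state
  obtain ⟨G, hG, h0, h0', h1, h2⟩ := FreeDirichletEnergy.exists_profile hL hη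
  set g3 : Space → ℝ := fun x => ∏ q, G (x q) with hg3
  set u : Space → ℂ := fun x => ((g3 x : ℝ) : ℂ) with hu
  obtain ⟨huC, hnorm, hE, hbox⟩ := FreeDirichletEnergy.mode_facts hL hG h0 h0' h1 h2 g3 hg3 u hu
  let Ψ : TrialState (n + 1) L :=
    { ψ := powFun u (n + 1)
      contDiff := contDiff_powFun huC (n + 1)
      eq_zero := fun X hX => by
        have : ∃ i, X i ∉ box L := by simpa [boxN] using hX
        obtain ⟨i, hi⟩ := this
        exact powFun_eq_zero_of_exists _ ⟨i, hbox _ hi⟩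
      symm := fun σ X => powFun_comp_perm _ σ X
      norm_eq := lintegral_powFun_sq huC hnorm (n + 1) }
  have hψ : Ψ.ψ = powFun u (n + 1) := rfl
  -- it is a `δ`-near-minimiser
  have hE0 : ENNReal.ofReal (3 * ((n + 1 : ℕ) : ℝ) * Real.pi ^ 2 / L ^ 2) ≤
      groundStateEnergy 0 (n + 1) L := by
    unfold groundStateEnergy
    exact le_iInf fun Φ => le_trans le_self_add (freeDirichletGap (by omega) hL Φ)
  have hEΨ : energy 0 Ψ ≤ groundStateEnergy 0 (n + 1) L + δ := by
    have hsplit : ((n + 1 : ℕ) : ℝ≥0∞) * ENNReal.ofReal (3 * ((Real.pi / L) ^ 2 + η)) =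
        ENNReal.ofReal (3 * ((n + 1 : ℕ) : ℝ) * Real.pi ^ 2 / L ^ 2) +
          ENNReal.ofReal (3 * ((n + 1 : ℕ) : ℝ) * η) := by
      rw [← ENNReal.ofReal_natCast, ← ENNReal.ofReal_mul (Nat.cast_nonneg _),
        ← ENNReal.ofReal_add (by positivity) (by positivity)]
      congr 1
      field_simp
    have hslack : ENNReal.ofReal (3 * ((n + 1 : ℕ) : ℝ) * η) ≤ δ := by
      calc ENNReal.ofReal (3 * ((n + 1 : ℕ) : ℝ) * η)
          ≤ ENNReal.ofReal (3 * ((n + 1 : ℕ) : ℝ) * η₀) := by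
            apply ENNReal.ofReal_le_ofReal
            exact mul_le_mul_of_nonneg_left (min_le_left _ _) (by positivity)
        _ = δ₁ := by
            rw [hη₀_def, show 3 * ((n + 1 : ℕ) : ℝ) * (δ₁.toReal / (3 * ((n + 1 : ℕ) : ℝ))) =
              δ₁.toReal by field_simp, ENNReal.ofReal_toReal hδ₁top]
        _ ≤ δ := hδ₁le
    calc energy 0 Ψ = ((n + 1 : ℕ) : ℝ≥0∞) * rawEnergy 0 (oneFun u) := by
          rw [energy_eq_rawEnergy]; exact rawEnergy_zero_powFun huC hnorm (n + 1)
      _ ≤ ((n + 1 : ℕ) : ℝ≥0∞) * ENNReal.ofReal (3 * ((Real.pi / L) ^ 2 + η)) := by gcongr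
      _ = _ := hsplit
      _ ≤ groundStateEnergy 0 (n + 1) L + δ := add_le_add hE0 hslack
  -- the stub's bound at level 2, bracket j
  have hmain := HΨ Ψ hEΨ 2 j (by norm_num) hbr1 hbr2 hwin
  dsimp only at hmain
  rw [levelSum_eq_cohSum, levelSum_eq_cohSum, hψ, cohSum_powFun huC hnorm,
    cohSum_powFun huC hnorm] at hmain
  -- the perturbation data
  obtain ⟨α, hα1, hα2, hpert⟩ := pairing_perturbation hL huC hnorm hbox hη.le hE
  set e : ℝ := Real.sqrt (η * L ^ 2 / Real.pi ^ 2) with he_def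
  have he0 : 0 ≤ e := Real.sqrt_nonneg _
  -- real level sums of the witness
  set X₂ : ℝ := ∑ m : Fin 3 → Fin (2 ^ 2), ‖∫ x, conj (dyMode L 2 m x) * u x‖ ^ 2 with hX₂_def
  set X₁ : ℝ := ∑ m : Fin 3 → Fin (2 ^ 1), ‖∫ x, conj (dyMode L 1 m x) * u x‖ ^ 2 with hX₁_def
  have hX₁0 : 0 ≤ X₁ := Finset.sum_nonneg fun m _ => sq_nonneg _
  have hS₂ : (∑ m : Fin 3 → Fin (2 ^ 2), (‖∫ x, conj (dyMode L 2 m x) * u x‖₊ : ℝ≥0∞) ^ 2) =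
      ENNReal.ofReal X₂ := by
    rw [hX₂_def, ENNReal.ofReal_sum_of_nonneg fun m _ => sq_nonneg _]
    exact Finset.sum_congr rfl fun m _ => nnnorm_coe_sq_eq_ofReal _
  have hS₁ : (∑ m : Fin 3 → Fin (2 ^ (2 - 1)),
      (‖∫ x, conj (dyMode L (2 - 1) m x) * u x‖₊ : ℝ≥0∞) ^ 2) = ENNReal.ofReal X₁ := by
    rw [hX₁_def, ENNReal.ofReal_sum_of_nonneg fun m _ => sq_nonneg _]
    exact Finset.sum_congr rfl fun m _ => nnnorm_coe_sq_eq_ofReal _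
  have hcast : ((n : ℝ≥0∞) + 1) = ((n + 1 : ℕ) : ℝ≥0∞) := by push_cast; ring
  have hmulsub : ((n + 1 : ℕ) : ℝ≥0∞) * ENNReal.ofReal X₂ - ((n + 1 : ℕ) : ℝ≥0∞) * ENNReal.ofReal X₁ =
      ((n + 1 : ℕ) : ℝ≥0∞) * ENNReal.ofReal (X₂ - X₁) := by
    rw [ENNReal.ofReal_sub _ hX₁0, ENNReal.mul_sub (fun _ _ => ENNReal.natCast_ne_top _)]
  rw [hS₂, hS₁, hcast, hmulsub] at hmain
  -- square the stub's bound: `(n+1)(X₂ − X₁) ≤ β_j² (n+1)`, so `X₂ − X₁ ≤ β_j² < 1/16`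
  have le_sq_of_rpow_half_le : ∀ {x y : ℝ≥0∞}, x ^ (1 / 2 : ℝ) ≤ y → x ≤ y ^ 2 := by
    intro x y h
    have h2 := ENNReal.rpow_le_rpow h (show (0 : ℝ) ≤ 2 by norm_num)
    rw [← ENNReal.rpow_mul] at h2
    norm_num at h2
    rw [← ENNReal.rpow_natCast]
    exact_mod_cast h2
  have hsq := le_sq_of_rpow_half_le hmain
  have hN2 : ((((n + 1 : ℕ) : ℝ≥0∞)) ^ (1 / 2 : ℝ)) ^ 2 = ((n + 1 : ℕ) : ℝ≥0∞) := by
    rw [← ENNReal.rpow_natCast, ← ENNReal.rpow_mul]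
    norm_num
  rw [mul_pow, hN2, ← ENNReal.ofReal_pow (hβ0 j), ← ENNReal.ofReal_natCast,
    ← ENNReal.ofReal_mul (Nat.cast_nonneg _), ← ENNReal.ofReal_mul (sq_nonneg _),
    ENNReal.ofReal_le_ofReal_iff (by positivity)] at hsq
  have hup : X₂ - X₁ ≤ β j ^ 2 := by
    have h' : ((n + 1 : ℕ) : ℝ) * (X₂ - X₁) ≤ ((n + 1 : ℕ) : ℝ) * β j ^ 2 := by linarith [hsq]
    exact le_of_mul_le_mul_left h' hNpos
  have hβj2 : β j ^ 2 < 1 / 16 := by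
    have := hβ0 j
    nlinarith
  -- the lower bound from the sine product
  have hB₂ := sum_norm_sq_pairing_two hL
  have hB₁ := sum_norm_sq_pairing_one hL
  have hlow2 : ‖α‖ ^ 2 * (512 / Real.pi ^ 6 * (4 - 2 * Real.sqrt 2) ^ 3) -
      e * ‖α‖ * (512 / Real.pi ^ 6 * (4 - 2 * Real.sqrt 2) ^ 3 + 64) ≤ X₂ := by
    have h := Finset.sum_le_sum fun (m : Fin 3 → Fin (2 ^ 2)) (_ : m ∈ Finset.univ) =>
      sq_lower_of_norm_sub_le he0 (hpert 2 m)
    simp only [integral_conj_dyMode_sineMode hL 2] at h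
    have hcard : (Finset.univ : Finset (Fin 3 → Fin (2 ^ 2))).card = 64 := by
      rw [Finset.card_univ, card_dyIndex]; norm_num
    rw [Finset.sum_sub_distrib, ← Finset.mul_sum, ← Finset.mul_sum, Finset.sum_add_distrib, hB₂,
      Finset.sum_const, hcard] at h
    rw [hX₂_def]
    simpa using h
  have hupp1 : X₁ ≤ ‖α‖ ^ 2 * (512 / Real.pi ^ 6) + e * ‖α‖ * (512 / Real.pi ^ 6 + 8) + 8 * e ^ 2 := by
    have h := Finset.sum_le_sum fun (m : Fin 3 → Fin (2 ^ 1)) (_ : m ∈ Finset.univ) =>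
      sq_upper_of_norm_sub_le he0 (hpert 1 m)
    simp only [integral_conj_dyMode_sineMode hL 1] at h
    have hcard : (Finset.univ : Finset (Fin 3 → Fin (2 ^ 1))).card = 8 := by
      rw [Finset.card_univ, card_dyIndex]; norm_num
    rw [Finset.sum_add_distrib, Finset.sum_add_distrib, ← Finset.mul_sum, ← Finset.mul_sum,
      Finset.sum_add_distrib, hB₁, Finset.sum_const, Finset.sum_const, hcard] at h
    rw [hX₁_def]
    simpa using h
  have hkey := key_numeric he0 hε hα2 hα1 hlow2 hupp1
  linarith

end Summit.AtomisticToContinuum.BoseEinsteinCondensation.Cruxes.DyadicCoherenceDefect.Birth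

end
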